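import Summits.MatrixMultiplication.MatrixMultiplication.Theses.TetrahedronCarving
import Summits.MatrixMultiplication.MatrixMultiplication.Theorems.TetrahedronTensorRectangular
import HarnessLib

/-!
# TetraResidualGroupingCeiling — the residual `TetraNoSaving` (item 33478) against the WHOLE
grouping class (decomp-mm lens 6 «barrier-complement carving», generation 18; residual-side kernel, part 1/2)

The cut of record is `ω(ℂ) = 2 ⟺ TetraFlat ∧ TetraNoSaving` (`Theses.TetrahedronCarving`, kernel
`Theorems.TetrahedronTensor.matrixMultiplication_iff_tetra`). The residual `TetraNoSaving : 2ω ≤ ω(K₄)`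
carries the tag IDEA-NEEDED: «a lower-bound transfer ⟨m,m,m⟩ ⇝ T(K₄)_n at rate m = n²; no grouping of
the four legs realises it». This file closes the remaining loophole of that sentence at the level of
exponents: not only no single grouping, but no PRODUCT OF GROUPINGS OF COPIES (interleaving allowed,
followed by any restriction) certifies the residual unless `ω = 2` already holds. Part 2
(`TetraResidualAlternatives`) records a dominated rectangular residual, the «why K₄» arithmetic and an
independence model.

## 1. The grouping class (combinatorics, `decide`)
A 3-GROUPING of the four legs of `T(K₄)_n` is a map `g : Fin 4 → Fin 3`. Grouped, the six EPR pairs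
become: `e_{pq}(g)` pairs shared between parties `p ≠ q`, and `6 − Σ e_{pq}` pairs INTERNAL to a party
(product vectors, invisible to rank). In the coordinates of the tree's `matMulTensor k m n`
(`⟨k,m,n⟩ = EPR₁₂(k) ⊗ EPR₂₃(m) ⊗ EPR₁₃(n)`, legs `k×n`, `k×m`, `m×n`) the grouped tensor is, up to
local isomorphism and the internal product vectors, `⟨n^{e₁₂}, n^{e₂₃}, n^{e₁₃}⟩`; the tree TYPES the
canonical instance `⟨N², N, N²⟩ ≤ T(K₄)_N` (`tensorRank_matMulTensor_le_tensorRankD_tetra`, shape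
`(2,1,2)`, `shape_canonical`). `shape_mem` / `shapeList_realised`: the 81 groupings realise EXACTLY the
ten shapes `(0,0,0), (3,0,0), (0,3,0), (0,0,3), (4,0,0), (0,4,0), (0,0,4), (2,1,2), (2,2,1), (1,2,2)`, and
a grouping sees at most `5` of the `6` edges (`shape_total_le_five`, `= 5` iff a rotation of `(2,1,2)`).

## 2. The class ceiling (exponent level, UNCONDITIONAL as stated)
THE CLASS 𝒢: take `N` copies, group copy `i` by `g_i`, multiply: the product is a padded
`⟨n^X, n^Y, n^Z⟩` with `(X,Y,Z) = Σ_i shape(g_i)`; restrict / degenerate it to any target and use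
`R(target) ≤ R(product) ≤ R₄(T(K₄)_n)^N`. Rank is restriction-monotone, so the strongest conclusion is
the product itself: `ω(X/N, Y/N, Z/N) ≤ ω(K₄)` (Lotti–Romani homogeneity). THEOREM
(`omegaRect_convexComb_shapes_le`: Jensen for the Lotti–Romani convex function `ω(·,·,·)` over the ten
shapes, each `≤ ω(2,1,2)` by `shape_omegaRect_le`): EVERY such conclusion is implied by the single
canonical grouping — `ω(avg shape) ≤ ω(2,1,2) ≤ ω(K₄)` (`groupingClass_le_omegaTetra`); a class SUCCESS
`2ω ≤ ω(avg shape)` is already the summit, and conversely (`groupingClass_certifies_residual_iff`, via the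
tree's `two_mul_omega_le_omegaRect_two_one_two_iff`). By-product: `(5/3)·ω ≤ ω(2,1,2)`
(`five_thirds_mul_omega_le_omegaRect_two_one_two`, the symmetrised grouping) — the class is worth exactly
`ω(2,1,2) ∈ [max(4, 5ω/3), ω+2]` while `TetraNoSaving` needs `2ω`: gap `≥ ω − 2`.
What is NOT typed here: the tensor-level dictionary `g(T(K₄)_n) ≅ ⟨n^{e₁₂}, n^{e₂₃}, n^{e₁₃}⟩ ⊗ (product
vectors)` for the 80 non-canonical groupings (routine padding; the canonical one is the tree's) — the
theorems below are statements about `ω(·,·,·)` at the ten shapes and need no dictionary.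

Sources: [cite: LottiRomani1983, §1 (p. 173)] (convexity/homogeneity of `ω(·,·,·)`), [cite: HuangPan1998,
§2 eq. (2.4)–(2.8)] (coordinate-plane values); tree `Theorems.TetrahedronTensorRectangular`,
`Theorems.ConeTensorResidual`.
-/

noncomputable section

set_option linter.dupNamespace false

open scoped BigOperators
open Literature.Computability.AlgebraicComplexity
open Summit.MatrixMultiplication.MatrixMultiplication.Theorems.TetrahedronTensor
open Summit.MatrixMultiplication.MatrixMultiplication.Theorems.ConeTensor
open Summit.MatrixMultiplication.MatrixMultiplication.Theses.TetrahedronCarving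

namespace Summit.MatrixMultiplication.MatrixMultiplication.Theorems.TetraResidualGroupingCeiling

/-! ## 1. The 81 three-groupings of the legs of `T(K₄)` and their ten shapes -/

/-- The six edges of `K₄` on the vertex set `Fin 4`, as pairs `(i, j)` with `i < j`. [folklore] -/
def k4Edges : List (Fin 4 × Fin 4) := [(0, 1), (0, 2), (0, 3), (1, 2), (1, 3), (2, 3)]

/-- `e_{pq}(g)`: the number of edges of `K₄` joining party `p` to party `q` under the grouping
`g : Fin 4 → Fin 3` (for `p ≠ q`: the EPR pairs shared by parties `p` and `q` after grouping). [folklore] -/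
def edgesBetween (g : Fin 4 → Fin 3) (p q : Fin 3) : ℕ :=
  (k4Edges.filter fun e => (g e.1 = p ∧ g e.2 = q) ∨ (g e.1 = q ∧ g e.2 = p)).length

/-- The SHAPE of a grouping in `⟨k, m, n⟩ = EPR₁₂(k) ⊗ EPR₂₃(m) ⊗ EPR₁₃(n)` exponent coordinates:
`(e₁₂, e₂₃, e₁₃)` — the grouped `T(K₄)_n` is a padded `⟨n^{e₁₂}, n^{e₂₃}, n^{e₁₃}⟩`. [folklore] -/
def shape (g : Fin 4 → Fin 3) : ℕ × ℕ × ℕ :=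
  (edgesBetween g 0 1, edgesBetween g 1 2, edgesBetween g 0 2)

/-- The ten shapes realised by 3-groupings of `K₄`: the empty ones (a party holds everything or two
parties hold two vertices each / three and one), and the three rotations of `(2,1,2)`. [folklore] -/
def shapeList : List (ℕ × ℕ × ℕ) :=
  [(0, 0, 0), (3, 0, 0), (0, 3, 0), (0, 0, 3), (4, 0, 0), (0, 4, 0), (0, 0, 4),
    (2, 1, 2), (2, 2, 1), (1, 2, 2)]

/-- A map out of `Fin 4` is the vector of its four values. [folklore] -/
theorem eq_vec (g : Fin 4 → Fin 3) : g = ![g 0, g 1, g 2, g 3] := by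
  funext i
  fin_cases i <;> rfl

/-- Vector form of `shape_mem` (the `decide` kernel). [folklore] -/
theorem shape_vec_mem : ∀ a b c d : Fin 3, shape ![a, b, c, d] ∈ shapeList := by decide

/-- **Every 3-grouping of the legs of `T(K₄)` has one of the ten shapes.** [folklore] -/
theorem shape_mem (g : Fin 4 → Fin 3) : shape g ∈ shapeList := by
  rw [eq_vec g]
  exact shape_vec_mem _ _ _ _

/-- **Each of the ten shapes is realised** by some grouping. [folklore] -/
theorem shapeList_realised : ∀ s ∈ shapeList, ∃ a b c d : Fin 3, shape ![a, b, c, d] = s := by decide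

/-- Vector form of `shape_total_le_five`. [folklore] -/
theorem shape_vec_total_le_five : ∀ a b c d : Fin 3,
    (shape ![a, b, c, d]).1 + (shape ![a, b, c, d]).2.1 + (shape ![a, b, c, d]).2.2 ≤ 5 := by decide

/-- **A 3-grouping sees at most five of the six edges** (pigeonhole: two vertices share a party and the
edge between them becomes a product vector). This `5 < 6` is the whole obstruction: `TetraNoSaving`
asks for the value `2ω = ω(2,2,2)` of all six edges. [folklore] -/
theorem shape_total_le_five (g : Fin 4 → Fin 3) :
    (shape g).1 + (shape g).2.1 + (shape g).2.2 ≤ 5 := by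
  rw [eq_vec g]
  exact shape_vec_total_le_five _ _ _ _

/-- Vector form of `shape_total_eq_five_iff`. [folklore] -/
theorem shape_vec_total_eq_five_iff : ∀ a b c d : Fin 3,
    (shape ![a, b, c, d]).1 + (shape ![a, b, c, d]).2.1 + (shape ![a, b, c, d]).2.2 = 5 ↔
      shape ![a, b, c, d] ∈ [((2 : ℕ), (1 : ℕ), (2 : ℕ)), (2, 2, 1), (1, 2, 2)] := by decide

/-- The groupings that see five edges are exactly those of shape a rotation of `(2,1,2)` (one pair of
vertices merged, the other two vertices alone). [folklore] -/
theorem shape_total_eq_five_iff (g : Fin 4 → Fin 3) :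
    (shape g).1 + (shape g).2.1 + (shape g).2.2 = 5 ↔
      shape g ∈ [((2 : ℕ), (1 : ℕ), (2 : ℕ)), (2, 2, 1), (1, 2, 2)] := by
  rw [eq_vec g]
  exact shape_vec_total_eq_five_iff _ _ _ _

/-! ## 2. The class ceiling at the level of exponents -/

section Ceiling

variable (F : Type) [Field F]

/-- Helper: a rectangular exponent with a closed-form value `≤ 4` is below `ω(2,1,2) ≥ 4`. [folklore] -/
theorem le_omegaRect_two_one_two_of_eq {x y z v : ℝ} (h : omegaRect F x y z = v) (hv : v ≤ 4) :
    omegaRect F x y z ≤ omegaRect F 2 1 2 :=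
  h.le.trans (hv.trans (four_le_omegaRect_two_one_two F))

/-- **Each of the ten shapes is worth at most `ω(2,1,2)`**: the empty shapes have the closed-form values
`0, 3, 4 ≤ 4 ≤ ω(2,1,2)` (Huang–Pan coordinate-plane values, information bound), the three rotations are
equal to `ω(2,1,2)` (permutation symmetry of `ω(·,·,·)`). [cite: HuangPan1998, §2 eq. (2.4) and (2.8) (p. 261–262)] -/
theorem shape_omegaRect_le {s : ℕ × ℕ × ℕ} (hs : s ∈ shapeList) :
    omegaRect F (s.1 : ℝ) (s.2.1 : ℝ) (s.2.2 : ℝ) ≤ omegaRect F 2 1 2 := by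
  simp only [shapeList, List.mem_cons, List.mem_nil_iff, or_false] at hs
  rcases hs with rfl | rfl | rfl | rfl | rfl | rfl | rfl | rfl | rfl | rfl
  · simpa using le_omegaRect_two_one_two_of_eq F
      (omegaRect_eq_add_of_nonpos₃ F (le_refl (0 : ℝ)) (le_refl (0 : ℝ)) (le_refl (0 : ℝ)))
      (by norm_num)
  · simpa using le_omegaRect_two_one_two_of_eq F
      (omegaRect_eq_add_of_nonpos₃ F (by norm_num : (0 : ℝ) ≤ 3) (le_refl (0 : ℝ)) (le_refl (0 : ℝ)))
      (by norm_num)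
  · simpa using le_omegaRect_two_one_two_of_eq F
      (omegaRect_eq_add_of_nonpos₁ F (le_refl (0 : ℝ)) (by norm_num : (0 : ℝ) ≤ 3) (le_refl (0 : ℝ)))
      (by norm_num)
  · simpa using le_omegaRect_two_one_two_of_eq F
      (omegaRect_eq_add_of_nonpos₁ F (le_refl (0 : ℝ)) (le_refl (0 : ℝ)) (by norm_num : (0 : ℝ) ≤ 3))
      (by norm_num)
  · simpa using le_omegaRect_two_one_two_of_eq F
      (omegaRect_eq_add_of_nonpos₃ F (by norm_num : (0 : ℝ) ≤ 4) (le_refl (0 : ℝ)) (le_refl (0 : ℝ)))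
      (by norm_num)
  · simpa using le_omegaRect_two_one_two_of_eq F
      (omegaRect_eq_add_of_nonpos₁ F (le_refl (0 : ℝ)) (by norm_num : (0 : ℝ) ≤ 4) (le_refl (0 : ℝ)))
      (by norm_num)
  · simpa using le_omegaRect_two_one_two_of_eq F
      (omegaRect_eq_add_of_nonpos₁ F (le_refl (0 : ℝ)) (le_refl (0 : ℝ)) (by norm_num : (0 : ℝ) ≤ 4))
      (by norm_num)
  · simp
  · simpa using (omegaRect_swap₂₃ F 2 1 2).ge
  · simpa using (omegaRect_swap₁₂ F 2 1 2).ge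

/-- **THE CLASS CEILING.** For every finite family of shapes `s i ∈ shapeList` and convex weights
`w i ≥ 0`, `Σ w i = 1`: `ω(Σ wᵢ sᵢ) ≤ ω(2,1,2)` — Jensen's inequality for the Lotti–Romani convex
function `(x,y,z) ↦ ω(x,y,z)` on the non-negative orthant, and `shape_omegaRect_le` termwise. Reading:
the normalised profile of ANY product of groupings of copies of `T(K₄)` (copy `i` grouped with shape `sᵢ`,
weight = multiplicity / number of copies) is worth at most the canonical single grouping.
[cite: LottiRomani1983, §1 (p. 173)] -/
theorem omegaRect_convexComb_shapes_le {ι : Type*} (t : Finset ι) (w : ι → ℝ) (s : ι → ℕ × ℕ × ℕ)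
    (hw : ∀ i ∈ t, 0 ≤ w i) (hw1 : ∑ i ∈ t, w i = 1) (hs : ∀ i ∈ t, s i ∈ shapeList) :
    omegaRect F (∑ i ∈ t, w i * (s i).1) (∑ i ∈ t, w i * (s i).2.1) (∑ i ∈ t, w i * (s i).2.2)
      ≤ omegaRect F 2 1 2 := by
  let p : ι → ℝ × ℝ × ℝ := fun i => (((s i).1 : ℝ), ((s i).2.1 : ℝ), ((s i).2.2 : ℝ))
  have hmem : ∀ i ∈ t, p i ∈ Set.Ici (0 : ℝ) ×ˢ (Set.Ici (0 : ℝ) ×ˢ Set.Ici (0 : ℝ)) := fun i _ =>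
    Set.mk_mem_prod (Set.mem_Ici.2 (Nat.cast_nonneg _))
      (Set.mk_mem_prod (Set.mem_Ici.2 (Nat.cast_nonneg _)) (Set.mem_Ici.2 (Nat.cast_nonneg _)))
  have hJ := (LottiRomani1983_convexOn F).map_sum_le hw hw1 hmem
  have h1 : (∑ i ∈ t, w i • p i).1 = ∑ i ∈ t, w i * (s i).1 := by
    simp [p, Prod.fst_sum]
  have h2 : (∑ i ∈ t, w i • p i).2.1 = ∑ i ∈ t, w i * (s i).2.1 := by
    simp [p, Prod.fst_sum, Prod.snd_sum]
  have h3 : (∑ i ∈ t, w i • p i).2.2 = ∑ i ∈ t, w i * (s i).2.2 := by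
    simp [p, Prod.snd_sum]
  simp only [h1, h2, h3, smul_eq_mul] at hJ
  refine hJ.trans ?_
  calc ∑ i ∈ t, w i * omegaRect F ((s i).1 : ℝ) ((s i).2.1 : ℝ) ((s i).2.2 : ℝ)
      ≤ ∑ i ∈ t, w i * omegaRect F 2 1 2 :=
        Finset.sum_le_sum fun i hi => mul_le_mul_of_nonneg_left (shape_omegaRect_le F (hs i hi)) (hw i hi)
    _ = omegaRect F 2 1 2 := by rw [← Finset.sum_mul, hw1, one_mul]

/-- **`N` copies, copy `i` grouped by `g i`**: the normalised profile `(Σᵢ shape (g i)) / N` is worth at most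
`ω(2,1,2)` (the case `t = Fin N`, `w ≡ 1/N` of the class ceiling). [cite: LottiRomani1983, §1 (p. 173)] -/
theorem omegaRect_avg_groupings_le (N : ℕ) (hN : 0 < N) (g : Fin N → (Fin 4 → Fin 3)) :
    omegaRect F ((∑ i, ((shape (g i)).1 : ℝ)) / N) ((∑ i, ((shape (g i)).2.1 : ℝ)) / N)
      ((∑ i, ((shape (g i)).2.2 : ℝ)) / N) ≤ omegaRect F 2 1 2 := by
  have hN' : (N : ℝ) ≠ 0 := by exact_mod_cast hN.ne'
  have hw1 : ∑ _i : Fin N, (1 : ℝ) / N = 1 := by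
    rw [Finset.sum_const, Finset.card_univ, Fintype.card_fin, nsmul_eq_mul]
    field_simp
  have key : omegaRect F (∑ i, 1 / (N : ℝ) * ((shape (g i)).1 : ℝ))
      (∑ i, 1 / (N : ℝ) * ((shape (g i)).2.1 : ℝ)) (∑ i, 1 / (N : ℝ) * ((shape (g i)).2.2 : ℝ))
        ≤ omegaRect F 2 1 2 :=
    omegaRect_convexComb_shapes_le F Finset.univ (fun _ => (1 : ℝ) / N) (fun i => shape (g i))
      (fun _ _ => by positivity) hw1 (fun i _ => shape_mem (g i))
  have e : ∀ x : Fin N → ℝ, ∑ i, 1 / (N : ℝ) * x i = (∑ i, x i) / N := fun x => by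
    rw [← Finset.mul_sum]
    field_simp
  rw [e, e, e] at key
  exact key

/-- **The grouping class is dominated by the canonical grouping**: every profile of the class is worth at
most `ω(K₄)`'s recorded lower bound `ω(2,1,2) ≤ ω(K₄)` — the class adds nothing to the tree's
`omegaRect_two_one_two_le_omegaTetra`. [folklore] -/
theorem groupingClass_le_omegaTetra (N : ℕ) (hN : 0 < N) (g : Fin N → (Fin 4 → Fin 3)) :
    omegaRect F ((∑ i, ((shape (g i)).1 : ℝ)) / N) ((∑ i, ((shape (g i)).2.1 : ℝ)) / N)
      ((∑ i, ((shape (g i)).2.2 : ℝ)) / N) ≤ omegaTetra F :=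
  (omegaRect_avg_groupings_le F N hN g).trans (omegaRect_two_one_two_le_omegaTetra F)

/-- **A success of the class is the summit**: if some product of groupings certified `TetraNoSaving`, i.e.
`2ω ≤ ω(its profile)`, then `ω(ℂ) = 2` outright (through `2ω ≤ ω(2,1,2) ⟺ ω = 2`). [folklore] -/
theorem matrixMultiplication_of_groupingClass_success (N : ℕ) (hN : 0 < N) (g : Fin N → (Fin 4 → Fin 3))
    (h : 2 * omega ℂ ≤ omegaRect ℂ ((∑ i, ((shape (g i)).1 : ℝ)) / N)
      ((∑ i, ((shape (g i)).2.1 : ℝ)) / N) ((∑ i, ((shape (g i)).2.2 : ℝ)) / N)) :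
    _root_.MatrixMultiplication :=
  two_mul_omega_le_omegaRect_two_one_two_iff.1 (h.trans (omegaRect_avg_groupings_le ℂ N hN g))

/-- The canonical grouping `{0,1} | {2} | {3}` (the tree's `⟨N², N, N²⟩ ≤ T(K₄)_N`) has shape `(2,1,2)`.
[folklore] -/
theorem shape_canonical : shape ![0, 0, 1, 2] = (2, 1, 2) := by decide

/-- **The grouping class certifies the residual iff the summit already holds**: some product of
groupings gives `2ω ≤ ω(profile)` ↔ `ω(ℂ) = 2` (→ by the class ceiling; ← by the canonical grouping,
`ω(2,1,2) ≥ 4 = 2ω`). This is the typed form of «no grouping of the four legs realises the transfer»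
in the docstring of item 33478, extended from single groupings to the whole class. [folklore] -/
theorem groupingClass_certifies_residual_iff :
    (∃ (N : ℕ) (_ : 0 < N) (g : Fin N → (Fin 4 → Fin 3)),
        2 * omega ℂ ≤ omegaRect ℂ ((∑ i, ((shape (g i)).1 : ℝ)) / N)
          ((∑ i, ((shape (g i)).2.1 : ℝ)) / N) ((∑ i, ((shape (g i)).2.2 : ℝ)) / N)) ↔
      _root_.MatrixMultiplication := by
  constructor
  · rintro ⟨N, hN, g, h⟩
    exact matrixMultiplication_of_groupingClass_success N hN g h
  · intro hS
    refine ⟨1, one_pos, fun _ => ![0, 0, 1, 2], ?_⟩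
    have hω : omega ℂ = 2 := (_root_.MatrixMultiplication_iff).1 hS
    simp only [Fin.sum_univ_one, shape_canonical, Nat.cast_ofNat, Nat.cast_one, div_one]
    rw [hω]
    have h4 := four_le_omegaRect_two_one_two ℂ
    linarith

/-- **The symmetrised grouping: `(5/3)·ω ≤ ω(2,1,2)`** (`ω(5/3,5/3,5/3) = (5/3)ω` by homogeneity, and the
barycentre of the three rotations of `(2,1,2)` is `(5/3,5/3,5/3)`). With `4 ≤ ω(2,1,2) ≤ ω + 2` this
brackets the worth of the whole class: `max(4, 5ω/3) ≤ ω(2,1,2) ≤ ω + 2 < 2ω` unless `ω = 2`.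
[cite: LottiRomani1983, §1 (p. 173)] -/
theorem five_thirds_mul_omega_le_omegaRect_two_one_two : 5 / 3 * omega F ≤ omegaRect F 2 1 2 := by
  -- step 1: (3/2, 2, 3/2) = ½(2,2,1) + ½(1,2,2)
  have hA := LottiRomani1983_convexComb_le F (x := 2) (y := 2) (z := 1) (x' := 1) (y' := 2) (z' := 2)
    (a := 1 / 2) (b := 1 / 2) (by norm_num) (by norm_num) (by norm_num) (by norm_num) (by norm_num)
    (by norm_num) (by norm_num) (by norm_num)
  have h221 : omegaRect F 2 2 1 = omegaRect F 2 1 2 := (omegaRect_swap₂₃ F 2 1 2).symm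
  have h122 : omegaRect F 1 2 2 = omegaRect F 2 1 2 := (omegaRect_swap₁₂ F 2 1 2).symm
  norm_num at hA
  rw [h221, h122] at hA
  -- step 2: (5/3,5/3,5/3) = ⅓(2,1,2) + ⅔(3/2,2,3/2)
  have hB := LottiRomani1983_convexComb_le F (x := 2) (y := 1) (z := 2) (x' := 3 / 2) (y' := 2)
    (z' := 3 / 2) (a := 1 / 3) (b := 2 / 3) (by norm_num) (by norm_num) (by norm_num) (by norm_num)
    (by norm_num) (by norm_num) (by norm_num) (by norm_num)
  norm_num at hB
  -- homogeneity: ω(5/3,5/3,5/3) = 5/3 ω(1,1,1)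
  have hH := LottiRomani1983_homogeneous F (ν := 5 / 3) (x := 1) (y := 1) (z := 1) (by norm_num)
    (by norm_num) (by norm_num) (by norm_num)
  rw [omegaRect_one_one_one] at hH
  norm_num at hH
  rw [hH] at hB
  linarith

end Ceiling

end Summit.MatrixMultiplication.MatrixMultiplication.Theorems.TetraResidualGroupingCeiling

end
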